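import Summits.AnomalousDissipation.AnomalousDissipation.Theorems.SolenoidalFractalHomogenisationLagrangianStepD1TailCrushState
import HarnessLib

/-!
# K1L_D `stub_D1_V0thg` (stmt-AnomalousDissipation-27980), R3′ lane, R3′-2 `D1TailCrushBound`: THE FIRST-HOPPER CENSUS and THE CRUSHED OLD STATE
# (the periodic response of every source slot of the cubature word is `C√ν`-small when its source switches on again)

Helper file of route `SolenoidalFractalHomogenisation` (`--supports stmt-AnomalousDissipation-27980 --as helper`; one-generation hand
`leafhand-ad-solenoidalfractalh-1` g1, road E-c).
* `first_hopper` — the `decide`d refinement of `LadderCrush.own_wraparound_hops` (C1 of `…SidebandPathCensus`): for every source slot `j'` of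
  `IsotropicCubatureWord` there is a slot `i ≠ j'` hopping `m_{j'}` (`vᵢ·m_{j'} ≠ 0`) such that every slot cyclically strictly between `j'` and `i` is static
  (`v_l·m_{j'} = 0`) — the FIRST hopper after `j'`;
* **`crushed_old_state`** — for every source slot `j'`: ν-free `C > 0`, `r₁ ∈ (0, 1/4]` with `‖N̄ (start¹_{j'}) v‖ ≤ C·√(r³)·(8π‖α¹_{j'}‖/r_ν)·‖P_{j'} v‖`
  for all `r ∈ (0, r₁]` (`ν = r³`), every block-window background and every `v`: the state of the response of `j'` at the moment its source switches on —
  the «old memory» entering lane A4's cases C/D/E and, after the static stretch, the ZERO-class pickups — is crushed (`crushed_state` at the end of the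
  first hopper + plain contraction to the next source start + periodicity);
* **`crushed_state_after`** — the same bound at every time `t` after the end of the first hopper `i` (exposed with its order facts) along which the source
  of `j'` stays off: the crushed replacement of `norm_responseExt_le_of_gap` for the pickups lying cyclically after the first hopper.
What is NOT here: the ε-twins of lane A4's per-pair cases fed by `crushed_old_state` / `crushed_state` (`D1TailCrushBound` proper) and the final
`RelSmall` via `residueTail_of_crushedSlotPairBounds_gTail`.  No definitions, no sorry.  NOT a proof of `stub_D1_V0thg`, of K1L_D or of AD; rung F-D1.A0.
-/

set_option linter.dupNamespace false

noncomputable section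

namespace Summit.AnomalousDissipation.AnomalousDissipation.Theorems.SolenoidalFractalHomogenisation.LagrangianStep.D1Tail

open Summit.AnomalousDissipation.AnomalousDissipation.Theorems
open Summit.AnomalousDissipation.AnomalousDissipation.Theorems.SolenoidalFractalHomogenisation.LagrangianStep
open Summit.AnomalousDissipation.AnomalousDissipation.Theorems.SolenoidalFractalHomogenisation.LagrangianStep.WCrossing
open Summit.AnomalousDissipation.AnomalousDissipation.Theorems.SolenoidalFractalHomogenisation.LagrangianStep.D1TailCert
open Summit.AnomalousDissipation.AnomalousDissipation.Theorems.SolenoidalFractalHomogenisation.LagrangianStep.Sideband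
open Summit.AnomalousDissipation.AnomalousDissipation.Theorems.SolenoidalFractalHomogenisation.PermissibleCarrier
  (period_pos start_nonneg start_add_tau_le_period)
open Summit.AnomalousDissipation.AnomalousDissipation.Theorems.SolenoidalFractalHomogenisation.RealisedQuasiStaticCellLaw (start_add_tau_le_start)
open Literature.Analysis Literature.Analysis.FluidPDE Literature.Analysis.FunctionSpaces Literature.Analysis.FunctionSpaces.Torus
open Literature.Analysis.FluidPDE.Torus Literature.Analysis.FluidPDE.LatticeShear
open Set Real Complex
open scoped InnerProductSpace

/-! ## §1 The first hopper of every source slot -/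

/-- **THE FIRST-HOPPER CENSUS of the cubature word**: every source slot `j'` has a slot `i ≠ j'` hopping `m_{j'}` with all cyclically intermediate slots
static. [cite: MeshalkinSinai1961, pp. 1700–1705] -/
theorem first_hopper : ∀ j' : Fin 26, ∃ i : Fin 26, i ≠ j' ∧
    (slots i).v 0 * (slots j').m 0 + (slots i).v 1 * (slots j').m 1 + (slots i).v 2 * (slots j').m 2 ≠ 0 ∧
    ∀ l : Fin 26, l ≠ j' → ((j' < l ∧ l < i) ∨ (i < j' ∧ (j' < l ∨ l < i))) →
      (slots l).v 0 * (slots j').m 0 + (slots l).v 1 * (slots j').m 1 + (slots l).v 2 * (slots j').m 2 = 0 := by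
  decide

/-! ## §2 The crushed old state -/

set_option maxHeartbeats 400000 in -- pre-budgeted (ops-buildfix rule): large statement
/-- **THE CRUSHED OLD STATE.**  For every source slot `j'` of the cubature word there are ν-free `C > 0`, `r₁ ∈ (0, 1/4]` such that for all `r ∈ (0, r₁]`
(`ν = r³`), every `S ∈ NearIso(10/11, 11/10) ∩ OddSectorial(τ ≤ 1/20)` and every `v`, the periodic response `N̄` of slot `j'` of
`W₁ = (cubatureWord.stretch MB).stretch (1/ν)` (`𝔸 = ν•S`, `γ₁ = 1`, `R = R0 ν`) satisfies `‖N̄ (start¹_{j'}) v‖ ≤ C·√(r³)·(8π‖α¹_{j'}‖/r_ν)·‖P_{j'} v‖`.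
[cite: BedrossianCotiZelati2017, §2 (hypocoercivity, enhanced dissipation)] [cite: ArmstrongVicol2025, §3] [cite: SandersVerhulstMurdock2007, Lemma 5.2.7] -/
theorem crushed_old_state (j' : Fin 26) :
    ∃ C r₁ : ℝ, 0 < C ∧ 0 < r₁ ∧ r₁ ≤ 1 / 4 ∧ ∀ {r : ℝ} (hr : 0 < r), r ≤ r₁ →
      ∀ {S : T4}, Torus.NearIso S (10 / 11) (11 / 10) → ∀ τ ∈ Icc (0:ℝ) (1 / 20), OddSectorial S τ → ∀ v : EuclideanSpace ℂ (Fin 3),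
      ‖responseExt ((cubatureWord.stretch MB MB_pos).stretch (1 / r ^ 3) (by positivity)) (r ^ 3 • S) 1 (R0 (r ^ 3)) j'
          (((cubatureWord.stretch MB MB_pos).stretch (1 / r ^ 3) (by positivity)).start j') v‖ ≤
        C * Real.sqrt (r ^ 3) * (8 * π * ‖slotAmp ((cubatureWord.stretch MB MB_pos).stretch (1 / r ^ 3) (by positivity)) j'‖ /
          min (1:ℝ) (4 * π ^ 2 * (r ^ 3 * (10 / 11))) * ‖transversalProj (cubatureWord.phase j').m v‖) := by
  obtain ⟨i, hij, hhop, hstat⟩ := first_hopper j'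
  obtain ⟨C, r₁, hC, hr₁, hr₁4, hcr⟩ := crushed_state j' i hij hhop hstat
  refine ⟨C, r₁, hC, hr₁, hr₁4, ?_⟩
  intro r hr hr1 S hS τ hτ hodd v
  have hν : 0 < r ^ 3 := pow_pos hr 3
  have h𝔸 : Torus.NearIso (r ^ 3 • S) (r ^ 3 * (10 / 11)) (r ^ 3 * (11 / 10)) := hS.smul hν.le
  have hN := isPeriodicResponse_cubature hν hS j'
  have hcrush := hcr hr hr1 hS τ hτ hodd v
  set W₁ := (cubatureWord.stretch MB MB_pos).stretch (1 / r ^ 3) (by positivity) with hW₁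
  -- plain contraction from the end of the hopping slot to the next start of the source slot
  have hcontr : ∀ {a b : ℝ}, a ≤ b → (∀ t ∈ Ico a b, slotEnvelope W₁ j' t = 0) →
      ‖responseExt W₁ (r ^ 3 • S) 1 (R0 (r ^ 3)) j' b v‖ ≤ ‖responseExt W₁ (r ^ 3 • S) 1 (R0 (r ^ 3)) j' a v‖ := by
    intro a b hab henv
    have h := norm_responseExt_le_exp_of_envelope_zero W₁ h𝔸 (by positivity : (0:ℝ) ≤ r ^ 3 * (10 / 11)) 1 (R0 (r ^ 3)) j' hN v hab henv
    refine h.trans (mul_le_of_le_one_left (norm_nonneg _) ?_)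
    rw [Real.exp_le_one_iff, neg_nonpos]
    exact mul_nonneg (le_min zero_le_one (by positivity)) (sub_nonneg.2 hab)
  have hτi : (W₁.phase i).τ = 1 / r ^ 3 * ((cubatureWord.stretch MB MB_pos).phase i).τ := rfl
  rcases lt_or_gt_of_ne hij with hlt | hgt
  · -- `i < j'`: the hopping slot ends before the source slot starts, in the same period
    have hle : W₁.start i + (W₁.phase i).τ ≤ W₁.start j' := start_add_tau_le_start W₁ hlt
    refine (hcontr hle fun t ht => hsrc_of_gt W₁ j' i t ⟨?_, ?_⟩).trans (by rw [hτi]; exact hcrush)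
    · exact (le_add_of_nonneg_right (W₁.phase i).τ_pos.le).trans ht.1
    · rw [sub_add_cancel]; exact ht.2.le
  · -- `j' < i`: contract to `start_{j'} + P` and use periodicity
    have hle : W₁.start i + (W₁.phase i).τ ≤ W₁.start j' + W₁.period :=
      (start_add_tau_le_period W₁ i).trans (le_add_of_nonneg_left (start_nonneg W₁ j'))
    have h := hcontr hle fun t ht => hsrc_of_lt W₁ hgt t ⟨(le_add_of_nonneg_right (W₁.phase i).τ_pos.le).trans ht.1, ht.2.le⟩
    rw [responseExt_add_period] at h
    exact h.trans (by rw [hτi]; exact hcrush)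


/-! ## §3 The crushed state at every later source-free time -/

set_option maxHeartbeats 400000 in -- pre-budgeted (ops-buildfix rule): large statement
/-- **THE CRUSHED STATE PERSISTS UNTIL THE SOURCE SWITCHES ON AGAIN.**  For every source slot `j'` there are its first hopper `i ≠ j'` and ν-free
`C > 0`, `r₁ ∈ (0, 1/4]` such that for all `r ∈ (0, r₁]` (`ν = r³`), every block-window background, every `v` and every time `t ≥ startᵢ¹ + τᵢ¹` with the
envelope of `j'` vanishing on `[startᵢ¹ + τᵢ¹, t)`: `‖N̄ t v‖ ≤ C·√(r³)·(8π‖α¹_{j'}‖/r_ν)·‖P_{j'} v‖` — the crushed replacement of lane A4's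
`norm_responseExt_le_of_gap` for every pickup slot lying cyclically after the first hopper. [cite: BedrossianCotiZelati2017, §2] [cite: ArmstrongVicol2025, §3] -/
theorem crushed_state_after (j' : Fin 26) :
    ∃ i : Fin 26, i ≠ j' ∧
      (slots i).v 0 * (slots j').m 0 + (slots i).v 1 * (slots j').m 1 + (slots i).v 2 * (slots j').m 2 ≠ 0 ∧
      (∀ l : Fin 26, l ≠ j' → ((j' < l ∧ l < i) ∨ (i < j' ∧ (j' < l ∨ l < i))) →
        (slots l).v 0 * (slots j').m 0 + (slots l).v 1 * (slots j').m 1 + (slots l).v 2 * (slots j').m 2 = 0) ∧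
    ∃ C r₁ : ℝ, 0 < C ∧ 0 < r₁ ∧ r₁ ≤ 1 / 4 ∧ ∀ {r : ℝ} (hr : 0 < r), r ≤ r₁ →
      ∀ {S : T4}, Torus.NearIso S (10 / 11) (11 / 10) → ∀ τ ∈ Icc (0:ℝ) (1 / 20), OddSectorial S τ → ∀ v : EuclideanSpace ℂ (Fin 3), ∀ t : ℝ,
      ((cubatureWord.stretch MB MB_pos).stretch (1 / r ^ 3) (by positivity)).start i + 1 / r ^ 3 * ((cubatureWord.stretch MB MB_pos).phase i).τ ≤ t →
      (∀ u ∈ Ico (((cubatureWord.stretch MB MB_pos).stretch (1 / r ^ 3) (by positivity)).start i +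
          1 / r ^ 3 * ((cubatureWord.stretch MB MB_pos).phase i).τ) t,
        slotEnvelope ((cubatureWord.stretch MB MB_pos).stretch (1 / r ^ 3) (by positivity)) j' u = 0) →
      ‖responseExt ((cubatureWord.stretch MB MB_pos).stretch (1 / r ^ 3) (by positivity)) (r ^ 3 • S) 1 (R0 (r ^ 3)) j' t v‖ ≤
        C * Real.sqrt (r ^ 3) * (8 * π * ‖slotAmp ((cubatureWord.stretch MB MB_pos).stretch (1 / r ^ 3) (by positivity)) j'‖ /
          min (1:ℝ) (4 * π ^ 2 * (r ^ 3 * (10 / 11))) * ‖transversalProj (cubatureWord.phase j').m v‖) := by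
  obtain ⟨i, hij, hhop, hstat⟩ := first_hopper j'
  obtain ⟨C, r₁, hC, hr₁, hr₁4, hcr⟩ := crushed_state j' i hij hhop hstat
  refine ⟨i, hij, hhop, hstat, C, r₁, hC, hr₁, hr₁4, ?_⟩
  intro r hr hr1 S hS τ hτ hodd v t het henv
  have hν : 0 < r ^ 3 := pow_pos hr 3
  have h𝔸 : Torus.NearIso (r ^ 3 • S) (r ^ 3 * (10 / 11)) (r ^ 3 * (11 / 10)) := hS.smul hν.le
  have hN := isPeriodicResponse_cubature hν hS j'
  have h := norm_responseExt_le_exp_of_envelope_zero ((cubatureWord.stretch MB MB_pos).stretch (1 / r ^ 3) (by positivity)) h𝔸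
    (by positivity : (0:ℝ) ≤ r ^ 3 * (10 / 11)) 1 (R0 (r ^ 3)) j' hN v het henv
  refine h.trans ((mul_le_of_le_one_left (norm_nonneg _) ?_).trans (hcr hr hr1 hS τ hτ hodd v))
  rw [Real.exp_le_one_iff, neg_nonpos]
  exact mul_nonneg (le_min zero_le_one (by positivity)) (sub_nonneg.2 het)

end Summit.AnomalousDissipation.AnomalousDissipation.Theorems.SolenoidalFractalHomogenisation.LagrangianStep.D1Tail

end
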